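import Summits.CriticalPhenomena.PercolationContinuityZ3.Theorems.PercLowPointHalfSpaceTallClusterMassBoundWallArmDoublingEquiv

/-!
# `TallClusterMassBound` (stmt-CriticalPhenomena-0912), line `onesided-halves` — stub D: only large scales matter

Stub D (`stub_wallArmPolyRegular`: `∃ C μ, ∀ 1 ≤ ρ ≤ r, π_s(ρ) ≤ C (r/ρ)^μ π_s(r)`, `π_s(n) = armProb p_c n`, the wall one-arm
probability of critical bond percolation on the half-space of `ℤ³`) is equivalent to uniform doubling with SOME constant
(`wallArmPolyRegular_iff_doubling`, file `…WallArmDoublingEquiv.lean`). Here the doubling is further reduced to its EVENTUAL form: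

  `wallArmPolyRegular_iff_eventually_doubling : D ↔ ∃ q₀ > 0, ∃ n₀, ∀ n ≥ n₀, q₀ π_s(n) ≤ π_s(2n)`,

the small scales `n ≤ n₀` being absorbed by the proved one-scale floor `π_s(m) ≥ 1/(588 m²)`
(`ReplicaOverlap.armProb_criticalProbI_ge`, from `φ_{p_c}(Λ_m) ≥ 1`) and `π_s ≤ 1`:
`π_s(2n) ≥ π_s(2(n₀+1)) ≥ 1/(2352 (n₀+1)²) ≥ π_s(n)/(2352 (n₀+1)²)` for `n ≤ n₀`. So the promoted item may be filed as a purely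
asymptotic statement. No definitions; criticality enters only through the two proved floors.
-/

noncomputable section

open MeasureTheory Finset Filter
open Literature.Probability.Percolation Literature.Probability.LatticeModels
open Summit.CriticalPhenomena.PercolationContinuityZ3.Theorems.TallClusterMassBound.Negative
open Summit.CriticalPhenomena.PercolationContinuityZ3.Theorems.TallClusterMassBound.ReplicaOverlap

namespace Summit.CriticalPhenomena.PercolationContinuityZ3.Theorems.TallClusterMassBound.OnesidedHalves

/-- **Eventual doubling ⟹ doubling at every scale.** If `q₀ π_s(n) ≤ π_s(2n)` for all `n ≥ n₀` (`q₀ > 0`), then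
`q₁ π_s(n) ≤ π_s(2n)` for all `n ≥ 1` with `q₁ = min q₀ (2352 (n₀+1)²)⁻¹ > 0` (small scales by the floor
`π_s(m) ≥ 1/(588 m²)` at `m = 2(n₀+1)` and monotonicity of `π_s`). [folklore] -/
theorem doubling_of_eventually_doubling {q₀ : ℝ} (hq0 : 0 < q₀) {n₀ : ℕ}
    (h : ∀ n : ℕ, n₀ ≤ n → q₀ * armProb (criticalProbI 3) n ≤ armProb (criticalProbI 3) (2 * n)) :
    ∃ q₁ : ℝ, 0 < q₁ ∧ ∀ n : ℕ, 1 ≤ n → q₁ * armProb (criticalProbI 3) n ≤ armProb (criticalProbI 3) (2 * n) := by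
  set p : unitInterval := criticalProbI 3 with hp
  set F : ℝ := (2352 * ((n₀ : ℝ) + 1) ^ 2)⁻¹ with hF
  have hF0 : 0 < F := by positivity
  refine ⟨min q₀ F, lt_min hq0 hF0, fun n hn => ?_⟩
  have hπn0 : 0 ≤ armProb p n := armProb_nonneg p n
  rcases le_or_gt n₀ n with hle | hlt
  · -- large scales: the hypothesis
    calc min q₀ F * armProb p n ≤ q₀ * armProb p n := mul_le_mul_of_nonneg_right (min_le_left _ _) hπn0
      _ ≤ armProb p (2 * n) := h n hle
  · -- small scales: π_s(2n) ≥ π_s(2(n₀+1)) ≥ 1/(588 (2(n₀+1))²) = F ≥ F π_s(n)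
    have hm : 1 ≤ 2 * (n₀ + 1) := by omega
    have hfloor := armProb_criticalProbI_ge hm
    have hmono : armProb p (2 * (n₀ + 1)) ≤ armProb p (2 * n) :=
      armProb_le_armProb_of_le p (by omega)
    have hcast : (588 : ℝ) * (((2 * (n₀ + 1) : ℕ) : ℝ)) ^ 2 = 2352 * ((n₀ : ℝ) + 1) ^ 2 := by
      push_cast; ring
    have hFle : F ≤ armProb p (2 * n) := by
      rw [hF, ← hcast, ← one_div]
      exact hfloor.trans hmono
    calc min q₀ F * armProb p n ≤ F * armProb p n := mul_le_mul_of_nonneg_right (min_le_right _ _) hπn0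
      _ ≤ F * 1 := mul_le_mul_of_nonneg_left (armProb_le_one p n) hF0.le
      _ = F := mul_one F
      _ ≤ armProb p (2 * n) := hFle

/-- **Stub D ⟺ EVENTUAL uniform wall-arm doubling with SOME constant**: the registered stub `stub_wallArmPolyRegular` of
line `onesided-halves` holds iff `∃ q₀ > 0, ∃ n₀, ∀ n ≥ n₀, q₀ π_s(n) ≤ π_s(2n)` at `p_c(ℤ³)` — a purely asymptotic
statement (via `wallArmPolyRegular_iff_doubling` and `doubling_of_eventually_doubling`). [folklore] -/
theorem wallArmPolyRegular_iff_eventually_doubling :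
    (∃ C μ : ℝ, ∀ ρ r : ℕ, 1 ≤ ρ → ρ ≤ r →
      armProb (criticalProbI 3) ρ ≤ C * ((r : ℝ) / ρ) ^ μ * armProb (criticalProbI 3) r) ↔
    (∃ q₀ : ℝ, 0 < q₀ ∧ ∃ n₀ : ℕ, ∀ n : ℕ, n₀ ≤ n →
      q₀ * armProb (criticalProbI 3) n ≤ armProb (criticalProbI 3) (2 * n)) := by
  rw [wallArmPolyRegular_iff_doubling]
  constructor
  · rintro ⟨q₀, hq0, h⟩
    exact ⟨q₀, hq0, 1, h⟩
  · rintro ⟨q₀, hq0, n₀, h⟩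
    exact doubling_of_eventually_doubling hq0 h

end Summit.CriticalPhenomena.PercolationContinuityZ3.Theorems.TallClusterMassBound.OnesidedHalves

end
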